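import Summits.Ventures.PercRepro.C041TwoExitSix

/-!
# ROW C-041 — THEOREM (TWO-EXIT BLOCK MAP): the six-vector of a two-exit attachment is the sum over the
colourings of the multigraph of the contributions of the statuses of its two exits (p6, gen 31; mine-3's C-041.md
§20 (c) BLOCK MAPS with two exits, §21 (b) the eight colourings of the triangle)

Setting of `C041TwoExitSix`: the exit vectors `exitVec`, the contribution `contrib` of one colouring by the
statuses of the exits, the fibre vector `fibVec`, and `Π(glue2) = ∑_ω fibVec ω`.  Here the fibre vector is
identified, status case by status case, through the five counting lemmas of `C041TwoExitCount` — `x * x'` (both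
exits merged), `x * θ_R x'` / `θ_R x * x'` (one merged), `θ_R (x * x')` (both separated in one sub-zone), `θ_R x *
θ_R x'` (both separated apart) — (`fibVec_eq`), and

* **`sixVec_glue2`** (THEOREM (TWO-EXIT BLOCK MAP)): `Π(glue2 Z₁ u u' Z a Z' a') = ∑_ω contrib (Π Z) (Π Z')
  (Mg a₁ u ω) (Rd a₁ u ω) (Mg a₁ u' ω) (Rd a₁ u' ω) (Mg u u' ω)` — the six-vector of the attachment is an
  explicit bilinear function of the six-vectors of the two zones, indexed by the colourings of the multigraph.

The triangle `a₁ – u – u' – a₁` (eight colourings) gives mine-3's `thetaTri` — `C041TriangleDict`.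
-/

namespace PercRepro

namespace ZoneZ

namespace TwoExit

open ZoneData TreeClosure Finset

variable {V₁ E₁ U₁ U₂ V E T₁ T₂ V' E' T₁' T₂' : Type}
variable (Z₁ : ZoneData V₁ E₁ U₁ U₂) (u u' : V₁) (Z : ZoneData V E T₁ T₂) (a : V) (Z' : ZoneData V' E' T₁' T₂')
  (a' : V') (a₁ : V₁)
variable [Fintype E₁] [DecidableEq E₁] [Fintype E] [DecidableEq E] [Fintype T₁] [DecidableEq T₁]
  [Fintype T₂] [DecidableEq T₂] [Fintype E'] [DecidableEq E'] [Fintype T₁'] [DecidableEq T₁']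
  [Fintype T₂'] [DecidableEq T₂']

omit [Fintype E₁] [DecidableEq E₁] in
/-- **The fibre vector is the contribution of the statuses.** -/
theorem fibVec_eq (ω : E₁ → Bool) :
    fibVec Z₁ u u' Z a Z' a' a₁ ω =
      contrib (Z.sixVec a) (Z'.sixVec a') (Z₁.Mg a₁ u ω) (Z₁.Rd a₁ u ω) (Z₁.Mg a₁ u' ω) (Z₁.Rd a₁ u' ω)
        (Z₁.Mg u u' ω) := by
  unfold contrib
  rw [exitOf_sixVec, exitOf_sixVec]
  by_cases hm : Z₁.Mg a₁ u ω <;> by_cases hm' : Z₁.Mg a₁ u' ω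
  · -- both merged
    rw [if_pos hm, if_pos hm']
    refine vec6_ext _ _ ?_ ?_ ?_ ?_ ?_ ?_
    · simp only [fibVec, exitVec, Pi.mul_apply, Matrix.cons_val]
      rw [card_fib_merged_merged Z₁ u u' Z a Z' a' a₁ ω hm hm' true true false (Or.inl rfl)]
      push_cast
      ring
    · simp only [fibVec, exitVec, Pi.mul_apply, Matrix.cons_val]
      rw [card_fib_merged_merged Z₁ u u' Z a Z' a' a₁ ω hm hm' false true false (Or.inr rfl)]
      push_cast
      ring
    · simp only [fibVec, exitVec, Pi.mul_apply, Matrix.cons_val]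
      rw [card_fib_merged_merged Z₁ u u' Z a Z' a' a₁ ω hm hm' true false false (Or.inl rfl)]
      push_cast
      ring
    · simp only [fibVec, exitVec, Pi.mul_apply, Matrix.cons_val]
      rw [card_fib_merged_merged Z₁ u u' Z a Z' a' a₁ ω hm hm' true true true (Or.inl rfl)]
      push_cast
      ring
    · simp only [fibVec, exitVec, Pi.mul_apply, Matrix.cons_val]
      rw [card_fib_merged_merged Z₁ u u' Z a Z' a' a₁ ω hm hm' false true true (Or.inr rfl)]
      push_cast
      ring
    · simp only [fibVec, exitVec, Pi.mul_apply, Matrix.cons_val]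
      rw [card_fib_merged_merged Z₁ u u' Z a Z' a' a₁ ω hm hm' true false true (Or.inl rfl)]
      push_cast
      ring
  · -- u merged, u' separated
    rw [if_pos hm, if_neg hm', thR_exitVec]
    refine vec6_ext _ _ ?_ ?_ ?_ ?_ ?_ ?_
    · simp only [fibVec, exitVec, nVec, Pi.mul_apply, Matrix.cons_val]
      rw [card_fib_merged_sep Z₁ u u' Z a Z' a' a₁ ω hm hm' true true false]
      push_cast
      ring
    · simp only [fibVec, exitVec, nVec, Pi.mul_apply, Matrix.cons_val]
      rw [card_fib_merged_sep Z₁ u u' Z a Z' a' a₁ ω hm hm' false true false]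
      push_cast
      ring
    · simp only [fibVec, exitVec, nVec, Pi.mul_apply, Matrix.cons_val]
      rw [card_fib_merged_sep Z₁ u u' Z a Z' a' a₁ ω hm hm' true false false]
      push_cast
      ring
    · simp only [fibVec, exitVec, nVec, Pi.mul_apply, Matrix.cons_val]
      rw [card_fib_merged_sep Z₁ u u' Z a Z' a' a₁ ω hm hm' true true true]
      push_cast
      ring
    · simp only [fibVec, exitVec, nVec, Pi.mul_apply, Matrix.cons_val]
      rw [card_fib_merged_sep Z₁ u u' Z a Z' a' a₁ ω hm hm' false true true]
      push_cast
      ring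
    · simp only [fibVec, exitVec, nVec, Pi.mul_apply, Matrix.cons_val]
      rw [card_fib_merged_sep Z₁ u u' Z a Z' a' a₁ ω hm hm' true false true]
      push_cast
      ring
  · -- u separated, u' merged
    rw [if_neg hm, if_pos hm', thR_exitVec]
    refine vec6_ext _ _ ?_ ?_ ?_ ?_ ?_ ?_
    · simp only [fibVec, exitVec, nVec, Pi.mul_apply, Matrix.cons_val]
      rw [card_fib_sep_merged Z₁ u u' Z a Z' a' a₁ ω hm hm' true true false]
      push_cast
      ring
    · simp only [fibVec, exitVec, nVec, Pi.mul_apply, Matrix.cons_val]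
      rw [card_fib_sep_merged Z₁ u u' Z a Z' a' a₁ ω hm hm' false true false]
      push_cast
      ring
    · simp only [fibVec, exitVec, nVec, Pi.mul_apply, Matrix.cons_val]
      rw [card_fib_sep_merged Z₁ u u' Z a Z' a' a₁ ω hm hm' true false false]
      push_cast
      ring
    · simp only [fibVec, exitVec, nVec, Pi.mul_apply, Matrix.cons_val]
      rw [card_fib_sep_merged Z₁ u u' Z a Z' a' a₁ ω hm hm' true true true]
      push_cast
      ring
    · simp only [fibVec, exitVec, nVec, Pi.mul_apply, Matrix.cons_val]
      rw [card_fib_sep_merged Z₁ u u' Z a Z' a' a₁ ω hm hm' false true true]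
      push_cast
      ring
    · simp only [fibVec, exitVec, nVec, Pi.mul_apply, Matrix.cons_val]
      rw [card_fib_sep_merged Z₁ u u' Z a Z' a' a₁ ω hm hm' true false true]
      push_cast
      ring
  · -- both separated
    rw [if_neg hm, if_neg hm']
    by_cases hbc : Z₁.Mg u u' ω
    · -- one sub-zone
      rw [if_pos hbc]
      refine vec6_ext _ _ ?_ ?_ ?_ ?_ ?_ ?_
      · simp only [fibVec, exitVec, thR, nAdm, kInv, Pi.mul_apply, Matrix.cons_val]
        have h := card_fib_joint Z₁ u u' Z a Z' a' a₁ ω hm hm' hbc true true false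
        have h' : ((#(fib Z₁ u u' Z a Z' a' a₁ ω true true false) +
            #(cls Z' a' true true false (Z₁.Rd a₁ u' ω)) * #(cls Z a true true false (Z₁.Rd a₁ u ω)) : ℕ) : ℝ) =
            ((#(cls Z' a' false true false (Z₁.Rd a₁ u' ω)) * #(cls Z a false true false (Z₁.Rd a₁ u ω)) +
              #(cls Z' a' true false false (Z₁.Rd a₁ u' ω)) * #(cls Z a true false false (Z₁.Rd a₁ u ω)) : ℕ) :
              ℝ) := by
          rw [h]
        push_cast at h'
        linarith
      · simp only [fibVec, exitVec, thR, nAdm, kInv, Pi.mul_apply, Matrix.cons_val]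
        have h := card_fib_joint Z₁ u u' Z a Z' a' a₁ ω hm hm' hbc false true false
        have h' : ((#(fib Z₁ u u' Z a Z' a' a₁ ω false true false) +
            #(cls Z' a' true true false (Z₁.Rd a₁ u' ω)) * #(cls Z a true true false (Z₁.Rd a₁ u ω)) : ℕ) : ℝ) =
            ((#(cls Z' a' false true false (Z₁.Rd a₁ u' ω)) * #(cls Z a false true false (Z₁.Rd a₁ u ω)) +
              #(cls Z' a' true false false (Z₁.Rd a₁ u' ω)) * #(cls Z a true false false (Z₁.Rd a₁ u ω)) : ℕ) :
              ℝ) := by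
          rw [h]
        push_cast at h'
        linarith
      · simp only [fibVec, exitVec, thR, nAdm, kInv, Pi.mul_apply, Matrix.cons_val]
        have h := card_fib_joint Z₁ u u' Z a Z' a' a₁ ω hm hm' hbc true false false
        have h' : ((#(fib Z₁ u u' Z a Z' a' a₁ ω true false false) +
            #(cls Z' a' true true false (Z₁.Rd a₁ u' ω)) * #(cls Z a true true false (Z₁.Rd a₁ u ω)) : ℕ) : ℝ) =
            ((#(cls Z' a' false true false (Z₁.Rd a₁ u' ω)) * #(cls Z a false true false (Z₁.Rd a₁ u ω)) +
              #(cls Z' a' true false false (Z₁.Rd a₁ u' ω)) * #(cls Z a true false false (Z₁.Rd a₁ u ω)) : ℕ) :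
              ℝ) := by
          rw [h]
        push_cast at h'
        linarith
      · simp only [fibVec, exitVec, thR, nAdm, kInv, Pi.mul_apply, Matrix.cons_val]
        have h := card_fib_joint Z₁ u u' Z a Z' a' a₁ ω hm hm' hbc true true true
        have h' : ((#(fib Z₁ u u' Z a Z' a' a₁ ω true true true) +
            #(cls Z' a' true true true (Z₁.Rd a₁ u' ω)) * #(cls Z a true true true (Z₁.Rd a₁ u ω)) : ℕ) : ℝ) =
            ((#(cls Z' a' false true true (Z₁.Rd a₁ u' ω)) * #(cls Z a false true true (Z₁.Rd a₁ u ω)) +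
              #(cls Z' a' true false true (Z₁.Rd a₁ u' ω)) * #(cls Z a true false true (Z₁.Rd a₁ u ω)) : ℕ) :
              ℝ) := by
          rw [h]
        push_cast at h'
        linarith
      · simp only [fibVec, exitVec, thR, nAdm, kInv, Pi.mul_apply, Matrix.cons_val]
        have h := card_fib_joint Z₁ u u' Z a Z' a' a₁ ω hm hm' hbc false true true
        have h' : ((#(fib Z₁ u u' Z a Z' a' a₁ ω false true true) +
            #(cls Z' a' true true true (Z₁.Rd a₁ u' ω)) * #(cls Z a true true true (Z₁.Rd a₁ u ω)) : ℕ) : ℝ) =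
            ((#(cls Z' a' false true true (Z₁.Rd a₁ u' ω)) * #(cls Z a false true true (Z₁.Rd a₁ u ω)) +
              #(cls Z' a' true false true (Z₁.Rd a₁ u' ω)) * #(cls Z a true false true (Z₁.Rd a₁ u ω)) : ℕ) :
              ℝ) := by
          rw [h]
        push_cast at h'
        linarith
      · simp only [fibVec, exitVec, thR, nAdm, kInv, Pi.mul_apply, Matrix.cons_val]
        have h := card_fib_joint Z₁ u u' Z a Z' a' a₁ ω hm hm' hbc true false true
        have h' : ((#(fib Z₁ u u' Z a Z' a' a₁ ω true false true) +
            #(cls Z' a' true true true (Z₁.Rd a₁ u' ω)) * #(cls Z a true true true (Z₁.Rd a₁ u ω)) : ℕ) : ℝ) =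
            ((#(cls Z' a' false true true (Z₁.Rd a₁ u' ω)) * #(cls Z a false true true (Z₁.Rd a₁ u ω)) +
              #(cls Z' a' true false true (Z₁.Rd a₁ u' ω)) * #(cls Z a true false true (Z₁.Rd a₁ u ω)) : ℕ) :
              ℝ) := by
          rw [h]
        push_cast at h'
        linarith
    · -- two sub-zones
      rw [if_neg hbc, thR_exitVec, thR_exitVec]
      refine vec6_ext _ _ ?_ ?_ ?_ ?_ ?_ ?_
      · simp only [fibVec, nVec, Pi.mul_apply, Matrix.cons_val]
        rw [card_fib_sep_sep Z₁ u u' Z a Z' a' a₁ ω hm hm' hbc true true false]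
        push_cast
        ring
      · simp only [fibVec, nVec, Pi.mul_apply, Matrix.cons_val]
        rw [card_fib_sep_sep Z₁ u u' Z a Z' a' a₁ ω hm hm' hbc false true false]
        push_cast
        ring
      · simp only [fibVec, nVec, Pi.mul_apply, Matrix.cons_val]
        rw [card_fib_sep_sep Z₁ u u' Z a Z' a' a₁ ω hm hm' hbc true false false]
        push_cast
        ring
      · simp only [fibVec, nVec, Pi.mul_apply, Matrix.cons_val]
        rw [card_fib_sep_sep Z₁ u u' Z a Z' a' a₁ ω hm hm' hbc true true true]
        push_cast
        ring
      · simp only [fibVec, nVec, Pi.mul_apply, Matrix.cons_val]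
        rw [card_fib_sep_sep Z₁ u u' Z a Z' a' a₁ ω hm hm' hbc false true true]
        push_cast
        ring
      · simp only [fibVec, nVec, Pi.mul_apply, Matrix.cons_val]
        rw [card_fib_sep_sep Z₁ u u' Z a Z' a' a₁ ω hm hm' hbc true false true]
        push_cast
        ring

/-- **THEOREM (TWO-EXIT BLOCK MAP)**: the six-vector of the two-exit attachment, at the anchor `a₁` of the
multigraph, is the sum over the colourings `ω` of `Z₁` of the contribution of the statuses of the two exits —
an explicit bilinear function of the six-vectors of the two zones. -/
theorem sixVec_glue2 :
    (glue2 Z₁ u u' Z a Z' a').sixVec (Sum.inl (Sum.inl a₁)) =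
      ∑ ω : E₁ → Bool, contrib (Z.sixVec a) (Z'.sixVec a') (Z₁.Mg a₁ u ω) (Z₁.Rd a₁ u ω) (Z₁.Mg a₁ u' ω)
        (Z₁.Rd a₁ u' ω) (Z₁.Mg u u' ω) := by
  rw [sixVec_eq_sum_fibVec]
  exact Finset.sum_congr rfl fun ω _ => fibVec_eq Z₁ u u' Z a Z' a' a₁ ω

end TwoExit

end ZoneZ

end PercRepro
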